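import Mathlib
import Summits.Schanuel.Schanuel.Theorems.SoloInformedPiELadder

/-!
# The characteristic-zero residue of Denis's change-of-variable proof of `ẽ ⟂ π̃`

Soloist seat `solo-Schanuel-informed`, session 6 (transfer analysis, atlas §2 E11 / §3 S5).

L. Denis, *Indépendance algébrique et exponentielle de Carlitz*, Acta Arith. **69** (1995) 75–89,
Cor. 2(a): for `q ≥ 3` the Carlitz analogues `e_C(1)` and `π̃` of `e` and `π` are algebraically
independent over `𝔽_q(T)`. The proof (§5, pp. 86–87) has two ingredients:

* a DICHOTOMY supplied by the Lindemann–Weierstrass analogue (Thiery) at the two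
  `k̄`-linearly independent algebraic points `1, μ` (`μ ∈ 𝔽̄_q ∖ 𝔽_q`);
* a SYMMETRY: the automorphism `σ_ξ : T ↦ ξT` of `𝔽_q((1/T))` fixes `1` and `π̃` and twists the
  Carlitz exponential, `σ_ξ ∘ e_C = e_ξ ∘ σ_ξ` with `e_ξ(z) = e_C(μz)/μ` (Lemme 16), so that it
  carries "`e_C(1)` algebraic over `k(π̃)`" to "`e_C(μ)` algebraic over `k(π̃)`", making the two
  alternatives of the dichotomy EQUIVALENT — hence both hold.

In characteristic zero the first ingredient ports verbatim and the second does not exist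
(`Aut_cont(ℂ) = {1, conj}` commutes with `exp`, whose Taylor coefficients are rational). This file
records exactly what survives, kernel-checked:

1. `algebraicIndependent_pair_exchange` — matroid exchange: `t` transcendental and `x, y`
   algebraically independent ⟹ `(t, x)` or `(t, y)` is an algebraically independent pair.
2. `algebraicIndependent_exp_pair_exchange` — with Lindemann–Weierstrass (tree:
   `algebraicIndependent_exp_holds`): for `t` transcendental and `α, β` algebraic and
   `ℚ`-linearly independent, `(t, e^α)` or `(t, e^β)` is algebraically independent.
3. `algebraicIndependent_pi_exp_one_or_pi_exp_I` — the dichotomy at the emblematic point: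
   `(π, e)` or `(π, e^{i})` is an algebraically independent pair.
4. `expOnePiAlgebraicIndependent_iff_imp`, `expOnePiAlgebraicIndependent_iff_propagation` —
   `e ⟂ π` (the tree's open `ExpOnePiAlgebraicIndependent`) is EQUIVALENT to the single missing
   implication `AI(π, e^{i}) → AI(π, e)`, i.e. to Denis's propagation step
   "`e ∈ acl ℚ(π)` ⟹ `e^{i} ∈ acl ℚ(π)`"; and `expOnePi_and_expI_of_iff` — if the two
   alternatives are equivalent (what `σ_ξ` gives for free in characteristic `p`), both hold.

No new definitions; statements over Mathlib's `AlgebraicIndependent` and the tree's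
`Literature.NumberTheory.Transcendental.ExpOnePiAlgebraicIndependent`.

References: [Denis1995] doi:10.4064/aa-69-1-75-89, Thm 3, Cor. 2(a), Lemmes 15–16 (pp. 86–87);
A. Thiery, Théorème de Lindemann–Weierstrass pour les modules de Drinfeld (thèse, Caen 1992).
-/

noncomputable section

open Complex IntermediateField
open Literature.NumberTheory.Transcendental (ExpOnePiAlgebraicIndependent)

namespace Summit.Schanuel.Schanuel.Theorems

/-! ### Matroid exchange for pairs -/

/-- **Exchange.** If `t` is transcendental and `x, y` are algebraically independent (over `ℚ`, in
`ℂ`), then `(t, x)` or `(t, y)` is an algebraically independent pair (augmentation in the algebraic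
matroid `AlgebraicIndependent.matroid ℚ ℂ`). [folklore] -/
theorem algebraicIndependent_pair_exchange {t x y : ℂ} (ht : Transcendental ℚ t)
    (hxy : AlgebraicIndependent ℚ ![x, y]) :
    AlgebraicIndependent ℚ ![t, x] ∨ AlgebraicIndependent ℚ ![t, y] := by
  classical
  have hne : x ≠ y := by
    intro h
    have h01 : (0 : Fin 2) = 1 := hxy.injective (by simp [h])
    exact absurd h01 (by decide)
  have hswap : ∀ {u v : ℂ}, AlgebraicIndependent ℚ ![u, v] → AlgebraicIndependent ℚ ![v, u] := by
    intro u v h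
    have h' := h.comp ![(1 : Fin 2), 0] (by decide)
    convert h' using 1
    funext i; fin_cases i <;> rfl
  by_cases htx : t = x
  · subst htx; exact Or.inr hxy
  by_cases hty : t = y
  · subst hty; exact Or.inl (hswap hxy)
  set M := AlgebraicIndependent.matroid ℚ ℂ with hM
  have hI : M.Indep {t} := by
    rw [hM, AlgebraicIndependent.matroid_indep_iff]
    exact algebraicIndependent_unique_type_iff.mpr (by simpa [Set.default_coe_singleton] using ht)
  have hJ : M.Indep (Set.range ![x, y]) := by
    rw [hM, AlgebraicIndependent.matroid_indep_iff]
    exact hxy.coe_range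
  have hr : Set.range ![x, y] = {x, y} := by
    simp only [Matrix.range_cons, Matrix.range_empty, Set.union_empty, Set.singleton_union]
  rw [hr] at hJ
  have hlt : ({t} : Set ℂ).encard < ({x, y} : Set ℂ).encard := by
    rw [Set.encard_singleton, Set.encard_pair hne]
    exact_mod_cast (by norm_num : (1 : ℕ) < 2)
  obtain ⟨e, he, hind⟩ := hI.augment hJ hlt
  simp only [Set.mem_sdiff, Set.mem_insert_iff, Set.mem_singleton_iff] at he
  obtain ⟨hexy, het⟩ := he
  rw [hM, AlgebraicIndependent.matroid_indep_iff] at hind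
  have hind' : AlgebraicIndependent ℚ (fun s : ↥(insert e ({t} : Set ℂ)) => (s : ℂ)) := hind
  have hte : AlgebraicIndependent ℚ ![t, e] := by
    have h2 := hind'.comp
      (![⟨t, Set.mem_insert_of_mem _ rfl⟩, ⟨e, Set.mem_insert _ _⟩] :
        Fin 2 → ↥(insert e ({t} : Set ℂ))) (by
        intro i j hij
        fin_cases i <;> fin_cases j
        · rfl
        · exact absurd (congrArg Subtype.val hij) (Ne.symm het)
        · exact absurd (congrArg Subtype.val hij) het
        · rfl)
    convert h2 using 1
    funext i; fin_cases i <;> rfl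
  rcases hexy with rfl | rfl
  exacts [Or.inl hte, Or.inr hte]

/-! ### With Lindemann–Weierstrass -/

/-- **Exchange against a Lindemann–Weierstrass pair.** For `t` transcendental and `α, β` algebraic
and `ℚ`-linearly independent, `(t, e^α)` or `(t, e^β)` is an algebraically independent pair
(`e^α, e^β` are algebraically independent by Lindemann–Weierstrass, tree
`algebraicIndependent_exp_holds`). [folklore] -/
theorem algebraicIndependent_exp_pair_exchange {t α β : ℂ} (ht : Transcendental ℚ t)
    (hα : IsAlgebraic ℚ α) (hβ : IsAlgebraic ℚ β) (hli : LinearIndependent ℚ ![α, β]) :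
    AlgebraicIndependent ℚ ![t, cexp α] ∨ AlgebraicIndependent ℚ ![t, cexp β] := by
  have h := Literature.NumberTheory.Transcendental.algebraicIndependent_exp_holds ![α, β]
    (Fin.forall_fin_two.mpr ⟨by simpa using hα, by simpa using hβ⟩) hli
  have h' : AlgebraicIndependent ℚ ![cexp α, cexp β] := by
    convert h using 1
    funext i; fin_cases i <;> rfl
  exact algebraicIndependent_pair_exchange ht h'

/-- **The dichotomy at the emblematic point** (what Denis's proof yields in characteristic zero):
`(π, e)` or `(π, e^{i})` is an algebraically independent pair — from Lindemann–Weierstrass at the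
points `1, i` (which are `ℚ`-linearly independent algebraic numbers), the transcendence of `π`
(tree `transcendental_pi_holds`) and matroid exchange. [this file] -/
theorem algebraicIndependent_pi_exp_one_or_pi_exp_I :
    AlgebraicIndependent ℚ ![(Real.pi : ℂ), cexp 1] ∨
      AlgebraicIndependent ℚ ![(Real.pi : ℂ), cexp I] := by
  have hli : LinearIndependent ℚ ![(1 : ℂ), I] := by
    rw [LinearIndependent.pair_iff]
    intro s t h
    have hre := congrArg Complex.re h
    have him := congrArg Complex.im h
    simp [Rat.smul_def] at hre him
    exact ⟨hre, him⟩
  have hpi : Transcendental ℚ (Real.pi : ℂ) := fun h =>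
    Literature.NumberTheory.Transcendental.transcendental_pi_holds
      ((isAlgebraic_algebraMap_iff (R := ℚ) (A := ℂ) (a := Real.pi) Complex.ofReal_injective).mp h)
  exact algebraicIndependent_exp_pair_exchange hpi isAlgebraic_one
    Literature.Barriers.Schanuel.isAlgebraic_I hli

/-- The tree's `ExpOnePiAlgebraicIndependent` (`e, π` algebraically independent reals) in the
complex pair form used here. [folklore] -/
theorem expOnePiAlgebraicIndependent_iff_complex :
    ExpOnePiAlgebraicIndependent ↔ AlgebraicIndependent ℚ ![(Real.pi : ℂ), cexp 1] := by
  have hswap : ∀ {u v : ℂ}, AlgebraicIndependent ℚ ![u, v] → AlgebraicIndependent ℚ ![v, u] := by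
    intro u v h
    have h' := h.comp ![(1 : Fin 2), 0] (by decide)
    convert h' using 1
    funext i; fin_cases i <;> rfl
  have hfun : (fun i => ((![Real.exp 1, Real.pi] i : ℝ) : ℂ)) = ![cexp 1, (Real.pi : ℂ)] := by
    funext i; fin_cases i <;> simp [Complex.ofReal_exp]
  constructor
  · intro h
    have hC : AlgebraicIndependent ℚ (fun i => ((![Real.exp 1, Real.pi] i : ℝ) : ℂ)) := by
      have h2 := h.map' (f := Complex.ofRealAm.restrictScalars ℚ) Complex.ofReal_injective
      convert h2 using 1
      funext i
      rfl
    rw [hfun] at hC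
    exact hswap hC
  · intro h
    have hC : AlgebraicIndependent ℚ ![cexp 1, (Real.pi : ℂ)] := hswap h
    rw [← hfun] at hC
    exact Literature.Barriers.Schanuel.algebraicIndependent_real_of_complex _ hC

/-- **`e ⟂ π` is the missing implication.** Given the dichotomy, the open conjecture
`ExpOnePiAlgebraicIndependent` is EQUIVALENT to `AI(π, e^{i}) → AI(π, e)` — the implication that
Denis's symmetry `σ_ξ` supplies for free in characteristic `p` and that nothing supplies in
characteristic `0`. [this file] -/
theorem expOnePiAlgebraicIndependent_iff_imp :
    ExpOnePiAlgebraicIndependent ↔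
      (AlgebraicIndependent ℚ ![(Real.pi : ℂ), cexp I] →
        AlgebraicIndependent ℚ ![(Real.pi : ℂ), cexp 1]) := by
  rw [expOnePiAlgebraicIndependent_iff_complex]
  exact ⟨fun h _ => h, fun h => algebraicIndependent_pi_exp_one_or_pi_exp_I.elim id h⟩

/-- The same in Denis's direction ("appliquer `σ_ξ` à une relation de dépendance algébrique"):
`e ⟂ π` iff an algebraic dependence of `(π, e)` PROPAGATES to one of `(π, e^{i})`. [this file] -/
theorem expOnePiAlgebraicIndependent_iff_propagation :
    ExpOnePiAlgebraicIndependent ↔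
      (¬ AlgebraicIndependent ℚ ![(Real.pi : ℂ), cexp 1] →
        ¬ AlgebraicIndependent ℚ ![(Real.pi : ℂ), cexp I]) := by
  rw [expOnePiAlgebraicIndependent_iff_imp]
  exact ⟨fun h hn hI => hn (h hI), fun h hI => by_contra fun hn => h hn hI⟩

/-- **Symmetry would finish it.** If the two alternatives of the dichotomy are equivalent — which is
what the twisted automorphism gives in characteristic `p` — then both `e ⟂ π` and `e^{i} ⟂ π`.
[this file] -/
theorem expOnePi_and_expI_of_iff
    (h : AlgebraicIndependent ℚ ![(Real.pi : ℂ), cexp 1] ↔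
      AlgebraicIndependent ℚ ![(Real.pi : ℂ), cexp I]) :
    ExpOnePiAlgebraicIndependent ∧ AlgebraicIndependent ℚ ![(Real.pi : ℂ), cexp I] := by
  rcases algebraicIndependent_pi_exp_one_or_pi_exp_I with h1 | h2
  · exact ⟨expOnePiAlgebraicIndependent_iff_complex.mpr h1, h.mp h1⟩
  · exact ⟨expOnePiAlgebraicIndependent_iff_complex.mpr (h.mpr h2), h2⟩

end Summit.Schanuel.Schanuel.Theorems
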